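import Summits.QuantumFields.BalabanUV.Beta.WindingIncrement

/-!
# Beta / LoopIncrement — the increment of a continuous logarithm around the boundary of a coordinate rectangle
# (β sub-cell, BINDER-OWNERS row CAP-k, lineage `b2b-balaban-beta-an5`, gen 23; node BETA-an5-g23-THEOREM-DB, leaf 2a; journal CLAIM l.14161)

The topological half of the one-variable argument principle on a period rectangle `[x₀, x₁] × [y₀, y₁]`, in the currency of
`Beta.WindingIncrement` (continuous logarithms along the four edges; no path integrals, no homotopies):

* §1 `hEdge`/`vEdge` (edge functions), `LoopLogs h x₀ x₁ y₀ y₁ Lb Lt Ll Lr` (continuous logarithms of `h` along the four edges),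
  `loopSum` (bottom + right − top − left increments) and `HasLoopIncr h x₀ x₁ y₀ y₁ δ`; the loop increment is WELL DEFINED
  (`LoopLogs.loopSum_eq`), MULTIPLICATIVE (`LoopLogs.mul` ∕ `zpow` ∕ `prod`), and invariant under changing `h` on the rectangle.
* §2 THE THREE COMPUTATIONS: (L3) for `h` periodic with period the width, the vertical edges cancel — `loopSum = Δ_bottom − Δ_top`
  (`LoopLogs.loopSum_eq_of_periodic`); (L2) for `z ↦ z − u` with `u` INSIDE the rectangle the loop increment is `2πI`
  (`hasLoopIncr_sub_const`, explicit principal logarithms on the four edges, the left edge crossing the cut); (L1) for `h` continuous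
  and ZERO-FREE on the filled rectangle the loop increment is `0` (`hasLoopIncr_zero_of_ne_zero`: sweep the top edge from `y₀` to
  `y₁`; the ratio lemma + Heine–Cantor keep the loop sum locally constant, the ε-chain lemma makes it constant).
* §3 FAMILIES: `incr_eq_of_family` — for a jointly continuous zero-free family `F τ` on `[x₀, x₁]` with `F τ x₁ = F τ x₀`, the
  increment of a continuous logarithm of `F τ` does not depend on `τ ∈ [τ₀, τ₁]` (the local-constancy engine of leaves 2b and 3).

HONEST FRAMING.  Kernel glue ([folklore] plane topology over Mathlib); no number, no binder instance, no certificate for the cell's `k₀`.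
Discharging `BetaPertH` would make Bałaban's ultraviolet stability unconditional — NOT the continuum limit, NOT the Clay problem.
0 `sorry`, 0 cite tags.
-/

namespace Summit.QuantumFields.BalabanUV.Beta.LoopIncrement

open Complex Set Metric
open Summit.QuantumFields.BalabanUV.Beta.WindingIncrement
open scoped Real

noncomputable section

/-! ## §1 Edge logarithms and the loop increment -/

/-- the HORIZONTAL EDGE function of `h` at height `y`: `x ↦ h (x + iy)`. [folklore] -/
def hEdge (h : ℂ → ℂ) (y : ℝ) : ℝ → ℂ := fun x => h (x + y * I)

/-- the VERTICAL EDGE function of `h` at abscissa `x`: `y ↦ h (x + iy)`. [folklore] -/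
def vEdge (h : ℂ → ℂ) (x : ℝ) : ℝ → ℂ := fun y => h (x + y * I)

/-- unfolding `hEdge`. [folklore] -/
@[simp] theorem hEdge_apply (h : ℂ → ℂ) (y x : ℝ) : hEdge h y x = h (x + y * I) := rfl

/-- unfolding `vEdge`. [folklore] -/
@[simp] theorem vEdge_apply (h : ℂ → ℂ) (x y : ℝ) : vEdge h x y = h (x + y * I) := rfl

/-- the point `x + iy` lies in the rectangle `s ×ℂ t` iff `x ∈ s` and `y ∈ t` (its real part is `x`, its imaginary part `y` —
`Literature…DZSReflection.re_line`/`im_line`, inlined by `simp`). [folklore] -/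
theorem mem_reProdIm_iff (x y : ℝ) (s t : Set ℝ) : ((x : ℂ) + y * I) ∈ s ×ℂ t ↔ x ∈ s ∧ y ∈ t := by
  rw [mem_reProdIm]; simp

/-- the map `x ↦ x + iy` is continuous. [folklore] -/
theorem continuous_hLine (y : ℝ) : Continuous fun x : ℝ => (x : ℂ) + y * I :=
  continuous_ofReal.add continuous_const

/-- the map `y ↦ x + iy` is continuous. [folklore] -/
theorem continuous_vLine (x : ℝ) : Continuous fun y : ℝ => (x : ℂ) + y * I :=
  continuous_const.add (continuous_ofReal.mul continuous_const)

/-- a horizontal edge of a rectangle on which `h` is continuous is a continuous edge function. [folklore] -/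
theorem continuousOn_hEdge {h : ℂ → ℂ} {x₀ x₁ y₀ y₁ y : ℝ} (hK : ContinuousOn h (Icc x₀ x₁ ×ℂ Icc y₀ y₁))
    (hy : y ∈ Icc y₀ y₁) : ContinuousOn (hEdge h y) (Icc x₀ x₁) :=
  hK.comp (continuous_hLine y).continuousOn fun x hx => (mem_reProdIm_iff x y _ _).mpr ⟨hx, hy⟩

/-- a vertical edge likewise. [folklore] -/
theorem continuousOn_vEdge {h : ℂ → ℂ} {x₀ x₁ y₀ y₁ x : ℝ} (hK : ContinuousOn h (Icc x₀ x₁ ×ℂ Icc y₀ y₁))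
    (hx : x ∈ Icc x₀ x₁) : ContinuousOn (vEdge h x) (Icc y₀ y₁) :=
  hK.comp (continuous_vLine x).continuousOn fun y hy => (mem_reProdIm_iff x y _ _).mpr ⟨hx, hy⟩

/-- CONTINUOUS LOGARITHMS ALONG THE FOUR EDGES of the rectangle `[x₀, x₁] × [y₀, y₁]`. [folklore] -/
structure LoopLogs (h : ℂ → ℂ) (x₀ x₁ y₀ y₁ : ℝ) (Lb Lt Ll Lr : ℝ → ℂ) : Prop where
  bot : IsContLog (hEdge h y₀) x₀ x₁ Lb
  top : IsContLog (hEdge h y₁) x₀ x₁ Lt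
  left : IsContLog (vEdge h x₀) y₀ y₁ Ll
  right : IsContLog (vEdge h x₁) y₀ y₁ Lr

/-- THE LOOP SUM of four edge logarithms: bottom + right − top − left increments (counter-clockwise). [folklore] -/
def loopSum (x₀ x₁ y₀ y₁ : ℝ) (Lb Lt Ll Lr : ℝ → ℂ) : ℂ :=
  (Lb x₁ - Lb x₀) + (Lr y₁ - Lr y₀) - (Lt x₁ - Lt x₀) - (Ll y₁ - Ll y₀)

/-- `δ` IS THE LOOP INCREMENT of `h` around the boundary of `[x₀, x₁] × [y₀, y₁]`. [folklore] -/
def HasLoopIncr (h : ℂ → ℂ) (x₀ x₁ y₀ y₁ : ℝ) (δ : ℂ) : Prop :=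
  ∃ Lb Lt Ll Lr, LoopLogs h x₀ x₁ y₀ y₁ Lb Lt Ll Lr ∧ δ = loopSum x₀ x₁ y₀ y₁ Lb Lt Ll Lr

namespace LoopLogs

variable {h h' : ℂ → ℂ} {x₀ x₁ y₀ y₁ : ℝ} {Lb Lt Ll Lr Lb' Lt' Ll' Lr' : ℝ → ℂ}

/-- **THE LOOP INCREMENT IS WELL DEFINED**: two choices of edge logarithms give the same loop sum. [folklore] -/
theorem loopSum_eq (H : LoopLogs h x₀ x₁ y₀ y₁ Lb Lt Ll Lr) (H' : LoopLogs h x₀ x₁ y₀ y₁ Lb' Lt' Ll' Lr')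
    (hx : x₀ ≤ x₁) (hy : y₀ ≤ y₁) : loopSum x₀ x₁ y₀ y₁ Lb Lt Ll Lr = loopSum x₀ x₁ y₀ y₁ Lb' Lt' Ll' Lr' := by
  simp only [loopSum]
  rw [H.bot.incr_eq H'.bot hx, H.top.incr_eq H'.top hx, H.left.incr_eq H'.left hy, H.right.incr_eq H'.right hy]

/-- the loop increment of these logarithms. [folklore] -/
theorem hasLoopIncr (H : LoopLogs h x₀ x₁ y₀ y₁ Lb Lt Ll Lr) : HasLoopIncr h x₀ x₁ y₀ y₁ (loopSum x₀ x₁ y₀ y₁ Lb Lt Ll Lr) :=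
  ⟨Lb, Lt, Ll, Lr, H, rfl⟩

/-- changing `h` to a function agreeing with it on the rectangle. [folklore] -/
theorem congr (H : LoopLogs h x₀ x₁ y₀ y₁ Lb Lt Ll Lr) (he : ∀ z ∈ Icc x₀ x₁ ×ℂ Icc y₀ y₁, h' z = h z)
    (hx : x₀ ≤ x₁) (hy : y₀ ≤ y₁) : LoopLogs h' x₀ x₁ y₀ y₁ Lb Lt Ll Lr where
  bot := H.bot.congr fun x hx => he _ ((mem_reProdIm_iff x y₀ _ _).mpr ⟨hx, le_rfl, hy⟩)
  top := H.top.congr fun x hx => he _ ((mem_reProdIm_iff x y₁ _ _).mpr ⟨hx, hy, le_rfl⟩)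
  left := H.left.congr fun y hy' => he _ ((mem_reProdIm_iff x₀ y _ _).mpr ⟨⟨le_rfl, hx⟩, hy'⟩)
  right := H.right.congr fun y hy' => he _ ((mem_reProdIm_iff x₁ y _ _).mpr ⟨⟨hx, le_rfl⟩, hy'⟩)

/-- PRODUCTS: edge logarithms add, loop sums add. [folklore] -/
theorem mul (H : LoopLogs h x₀ x₁ y₀ y₁ Lb Lt Ll Lr) (H' : LoopLogs h' x₀ x₁ y₀ y₁ Lb' Lt' Ll' Lr') :
    LoopLogs (fun z => h z * h' z) x₀ x₁ y₀ y₁ (fun x => Lb x + Lb' x) (fun x => Lt x + Lt' x)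
      (fun y => Ll y + Ll' y) (fun y => Lr y + Lr' y) :=
  ⟨H.bot.mul H'.bot, H.top.mul H'.top, H.left.mul H'.left, H.right.mul H'.right⟩

/-- INTEGER POWERS. [folklore] -/
theorem zpow (H : LoopLogs h x₀ x₁ y₀ y₁ Lb Lt Ll Lr) (n : ℤ) :
    LoopLogs (fun z => h z ^ n) x₀ x₁ y₀ y₁ (fun x => n * Lb x) (fun x => n * Lt x) (fun y => n * Ll y)
      (fun y => n * Lr y) :=
  ⟨H.bot.zpow n, H.top.zpow n, H.left.zpow n, H.right.zpow n⟩

end LoopLogs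

/-- the loop sum of a product is the sum of the loop sums. [folklore] -/
theorem loopSum_add (x₀ x₁ y₀ y₁ : ℝ) (Lb Lt Ll Lr Lb' Lt' Ll' Lr' : ℝ → ℂ) :
    loopSum x₀ x₁ y₀ y₁ (fun x => Lb x + Lb' x) (fun x => Lt x + Lt' x) (fun y => Ll y + Ll' y) (fun y => Lr y + Lr' y)
      = loopSum x₀ x₁ y₀ y₁ Lb Lt Ll Lr + loopSum x₀ x₁ y₀ y₁ Lb' Lt' Ll' Lr' := by
  simp only [loopSum]; ring

/-- the loop sum of an integer power. [folklore] -/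
theorem loopSum_zpow (x₀ x₁ y₀ y₁ : ℝ) (Lb Lt Ll Lr : ℝ → ℂ) (n : ℤ) :
    loopSum x₀ x₁ y₀ y₁ (fun x => n * Lb x) (fun x => n * Lt x) (fun y => n * Ll y) (fun y => n * Lr y)
      = n * loopSum x₀ x₁ y₀ y₁ Lb Lt Ll Lr := by
  simp only [loopSum]; ring

namespace HasLoopIncr

variable {h h' : ℂ → ℂ} {x₀ x₁ y₀ y₁ : ℝ} {δ δ' : ℂ}

/-- UNIQUENESS of the loop increment. [folklore] -/
theorem unique (H : HasLoopIncr h x₀ x₁ y₀ y₁ δ) (H' : HasLoopIncr h x₀ x₁ y₀ y₁ δ') (hx : x₀ ≤ x₁) (hy : y₀ ≤ y₁) :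
    δ = δ' := by
  obtain ⟨_, _, _, _, HL, rfl⟩ := H
  obtain ⟨_, _, _, _, HL', rfl⟩ := H'
  exact HL.loopSum_eq HL' hx hy

/-- changing `h` on the rectangle to an equal function. [folklore] -/
theorem congr (H : HasLoopIncr h x₀ x₁ y₀ y₁ δ) (he : ∀ z ∈ Icc x₀ x₁ ×ℂ Icc y₀ y₁, h' z = h z) (hx : x₀ ≤ x₁)
    (hy : y₀ ≤ y₁) : HasLoopIncr h' x₀ x₁ y₀ y₁ δ := by
  obtain ⟨Lb, Lt, Ll, Lr, HL, rfl⟩ := H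
  exact ⟨Lb, Lt, Ll, Lr, HL.congr he hx hy, rfl⟩

/-- MULTIPLICATIVITY: the loop increment of a product is the sum. [folklore] -/
theorem mul (H : HasLoopIncr h x₀ x₁ y₀ y₁ δ) (H' : HasLoopIncr h' x₀ x₁ y₀ y₁ δ') :
    HasLoopIncr (fun z => h z * h' z) x₀ x₁ y₀ y₁ (δ + δ') := by
  obtain ⟨Lb, Lt, Ll, Lr, HL, rfl⟩ := H
  obtain ⟨Lb', Lt', Ll', Lr', HL', rfl⟩ := H'
  exact ⟨_, _, _, _, HL.mul HL', (loopSum_add ..).symm⟩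

/-- INTEGER POWERS. [folklore] -/
theorem zpow (H : HasLoopIncr h x₀ x₁ y₀ y₁ δ) (n : ℤ) : HasLoopIncr (fun z => h z ^ n) x₀ x₁ y₀ y₁ (n * δ) := by
  obtain ⟨Lb, Lt, Ll, Lr, HL, rfl⟩ := H
  exact ⟨_, _, _, _, HL.zpow n, (loopSum_zpow ..).symm⟩

/-- FINITE PRODUCTS: the loop increment of `∏ i ∈ S, h i` is `∑ i ∈ S, δ i`. [folklore] -/
theorem prod {ι : Type*} (S : Finset ι) {Φ : ι → ℂ → ℂ} {Δ : ι → ℂ}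
    (H : ∀ i ∈ S, HasLoopIncr (Φ i) x₀ x₁ y₀ y₁ (Δ i)) :
    HasLoopIncr (fun z => ∏ i ∈ S, Φ i z) x₀ x₁ y₀ y₁ (∑ i ∈ S, Δ i) := by
  classical
  induction S using Finset.induction_on with
  | empty =>
    refine ⟨fun _ => 0, fun _ => 0, fun _ => 0, fun _ => 0, ⟨?_, ?_, ?_, ?_⟩, by simp [loopSum]⟩ <;>
      exact ⟨continuousOn_const, fun _ _ => by simp⟩
  | insert a S ha ih =>
    have h1 := (H a (Finset.mem_insert_self a S)).mul (ih fun i hi => H i (Finset.mem_insert_of_mem hi))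
    have e : (fun z => ∏ i ∈ insert a S, Φ i z) = fun z => Φ a z * ∏ i ∈ S, Φ i z :=
      funext fun z => Finset.prod_insert ha
    rw [Finset.sum_insert ha, e]
    exact h1

end HasLoopIncr

/-! ## §2 The three computations -/

section Periodic

variable {h : ℂ → ℂ} {x₀ x₁ y₀ y₁ : ℝ} {Lb Lt Ll Lr : ℝ → ℂ}

/-- for `h` periodic with period the width `x₁ − x₀`, the two vertical edge functions coincide. [folklore] -/
theorem vEdge_eq_of_periodic (hper : ∀ z, h (z + (x₁ - x₀ : ℝ)) = h z) : vEdge h x₁ = vEdge h x₀ := by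
  funext y
  simp only [vEdge_apply]
  rw [← hper ((x₀ : ℂ) + y * I)]
  congr 1; push_cast; ring

/-- **(L3) PERIODIC CANCELLATION**: for `h` periodic with period the width, the vertical edges cancel and the loop sum is
`Δ_bottom − Δ_top`. [folklore] -/
theorem LoopLogs.loopSum_eq_of_periodic (H : LoopLogs h x₀ x₁ y₀ y₁ Lb Lt Ll Lr) (hy : y₀ ≤ y₁)
    (hper : ∀ z, h (z + (x₁ - x₀ : ℝ)) = h z) :
    loopSum x₀ x₁ y₀ y₁ Lb Lt Ll Lr = (Lb x₁ - Lb x₀) - (Lt x₁ - Lt x₀) := by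
  have hR : IsContLog (vEdge h x₀) y₀ y₁ Lr := by
    have e := vEdge_eq_of_periodic hper
    exact H.right.congr fun y _ => by rw [← e]
  simp only [loopSum]
  rw [hR.incr_eq H.left hy]; ring

/-- **(L3′)**: for such `h`, continuous and non-vanishing on the left edge, with ANY logarithms `Lb`, `Lt` of the bottom and top edges,
`Δ_bottom − Δ_top` IS the loop increment. [folklore] -/
theorem hasLoopIncr_of_periodic (hy : y₀ ≤ y₁) (hper : ∀ z, h (z + (x₁ - x₀ : ℝ)) = h z)
    (hb : IsContLog (hEdge h y₀) x₀ x₁ Lb) (ht : IsContLog (hEdge h y₁) x₀ x₁ Lt)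
    (hlc : ContinuousOn (vEdge h x₀) (Icc y₀ y₁)) (hlz : ∀ y ∈ Icc y₀ y₁, vEdge h x₀ y ≠ 0) :
    HasLoopIncr h x₀ x₁ y₀ y₁ ((Lb x₁ - Lb x₀) - (Lt x₁ - Lt x₀)) := by
  obtain ⟨Ll, hLl⟩ := exists_isContLog hlc hlz
  have hLr : IsContLog (vEdge h x₁) y₀ y₁ Ll := by
    have e := vEdge_eq_of_periodic hper
    exact hLl.congr fun y _ => by rw [e]
  have H : LoopLogs h x₀ x₁ y₀ y₁ Lb Lt Ll Ll := ⟨hb, ht, hLl, hLr⟩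
  have := H.hasLoopIncr
  rwa [H.loopSum_eq_of_periodic hy hper] at this

end Periodic

section Linear

/-- the principal logarithm of `−w` for `Im w > 0`: `log (−w) = log w − πI`. [folklore] -/
theorem log_neg_of_im_pos {w : ℂ} (hw : 0 < w.im) : log (-w) = log w - π * I := by
  apply Complex.ext
  · simp [log_re]
  · simp [log_im, arg_neg_eq_arg_sub_pi_of_im_pos hw]

/-- **(L2) THE LOOP INCREMENT OF `z ↦ z − u` AROUND A RECTANGLE CONTAINING `u` IN ITS INTERIOR IS `2πI`** (principal logarithms
on the bottom/right/top edges — lower half-plane, right half-plane, upper half-plane — and `log (u − z) + πI` on the left edge,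
which crosses the cut; the corner values match except at the bottom-left corner, where they differ by `2πI`). [folklore] -/
theorem hasLoopIncr_sub_const {u : ℂ} {x₀ x₁ y₀ y₁ : ℝ} (hx₀ : x₀ < u.re) (hx₁ : u.re < x₁) (hy₀ : y₀ < u.im)
    (hy₁ : u.im < y₁) : HasLoopIncr (fun z => z - u) x₀ x₁ y₀ y₁ (2 * π * I) := by
  -- the four edge logarithms
  have hb : IsContLog (hEdge (fun z => z - u) y₀) x₀ x₁ (fun x => log ((x : ℂ) + y₀ * I - u)) := by
    refine IsContLog.of_mem_slitPlane (((continuous_hLine y₀).sub continuous_const).continuousOn) fun x _ => ?_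
    exact mem_slitPlane_iff.mpr (Or.inr (by simp; linarith))
  have ht : IsContLog (hEdge (fun z => z - u) y₁) x₀ x₁ (fun x => log ((x : ℂ) + y₁ * I - u)) := by
    refine IsContLog.of_mem_slitPlane (((continuous_hLine y₁).sub continuous_const).continuousOn) fun x _ => ?_
    exact mem_slitPlane_iff.mpr (Or.inr (by simp; linarith))
  have hr : IsContLog (vEdge (fun z => z - u) x₁) y₀ y₁ (fun y => log ((x₁ : ℂ) + y * I - u)) := by
    refine IsContLog.of_mem_slitPlane (((continuous_vLine x₁).sub continuous_const).continuousOn) fun y _ => ?_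
    exact mem_slitPlane_iff.mpr (Or.inl (by simp; linarith))
  have hl : IsContLog (vEdge (fun z => z - u) x₀) y₀ y₁ (fun y => log (u - ((x₀ : ℂ) + y * I)) + π * I) := by
    refine ⟨?_, fun y _ => ?_⟩
    · refine ContinuousOn.add (ContinuousOn.clog (continuousOn_const.sub (continuous_vLine x₀).continuousOn)
        fun y _ => mem_slitPlane_iff.mpr (Or.inl (by simp; linarith))) continuousOn_const
    · have hne : u - ((x₀ : ℂ) + y * I) ≠ 0 := by
        intro h0
        have := congrArg Complex.re h0
        simp at this; linarith
      rw [exp_add_pi_mul_I, exp_log hne]; simp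
  refine ⟨_, _, _, _, ⟨hb, ht, hl, hr⟩, ?_⟩
  -- the corner identities
  have c3 : log (u - ((x₀ : ℂ) + y₁ * I)) + π * I = log ((x₀ : ℂ) + y₁ * I - u) := by
    have e : u - ((x₀ : ℂ) + y₁ * I) = -((x₀ : ℂ) + y₁ * I - u) := by ring
    rw [e, log_neg_of_im_pos (by simp; linarith)]; ring
  have c4 : log (u - ((x₀ : ℂ) + y₀ * I)) + π * I = log ((x₀ : ℂ) + y₀ * I - u) + 2 * π * I := by
    have e : u - ((x₀ : ℂ) + y₀ * I) = -((x₀ : ℂ) + y₀ * I - u) := by ring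
    -- `log (−w) = log w + πI` for `Im w < 0` (≡ `Literature…RandomPlanarGeometry.log_neg_of_im_neg`, inlined)
    have hneg : ∀ w : ℂ, w.im < 0 → log (-w) = log w + π * I := fun w hw => by
      apply Complex.ext
      · simp [log_re]
      · simp [log_im, arg_neg_eq_arg_add_pi_of_im_neg hw]
    rw [e, hneg _ (by simp; linarith)]; ring
  simp only [loopSum]
  rw [c3, c4]; ring

end Linear

/-! ## §3 Families: the increment is locally constant, hence constant, in a parameter -/

/-- a positive lower bound for a continuous non-vanishing function on a compact set. [folklore] -/
theorem exists_pos_le_norm_of_isCompact {X : Type*} [TopologicalSpace X] {K : Set X} (hK : IsCompact K)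
    (hne : K.Nonempty) {F : X → ℂ} (hF : ContinuousOn F K) (hz : ∀ p ∈ K, F p ≠ 0) :
    ∃ m : ℝ, 0 < m ∧ ∀ p ∈ K, m ≤ ‖F p‖ := by
  obtain ⟨p₀, hp₀, hmin⟩ := hK.exists_isMinOn hne hF.norm
  exact ⟨‖F p₀‖, norm_pos_iff.mpr (hz p₀ hp₀), fun p hp => hmin hp⟩

/-- **INCREMENTS IN A FAMILY**: for a jointly continuous, non-vanishing family `F τ` (`τ ∈ [τ₀, τ₁]`) on `[x₀, x₁]` with
`F τ x₁ = F τ x₀` for every `τ`, the increment of a continuous logarithm of `F τ` over `[x₀, x₁]` does not depend on `τ`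
(Heine–Cantor on the compact parameter × variable rectangle gives a uniform step on which the ratio lemma applies; ε-chain). [folklore] -/
theorem incr_eq_of_family {F : ℝ → ℝ → ℂ} {τ₀ τ₁ x₀ x₁ : ℝ} (hx : x₀ ≤ x₁)
    (hF : ContinuousOn (fun p : ℝ × ℝ => F p.1 p.2) (Icc τ₀ τ₁ ×ˢ Icc x₀ x₁))
    (hne : ∀ τ ∈ Icc τ₀ τ₁, ∀ x ∈ Icc x₀ x₁, F τ x ≠ 0) (hends : ∀ τ ∈ Icc τ₀ τ₁, F τ x₁ = F τ x₀)
    {τ τ' : ℝ} (hτ : τ ∈ Icc τ₀ τ₁) (hτ' : τ' ∈ Icc τ₀ τ₁) {L L' : ℝ → ℂ}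
    (hL : IsContLog (F τ) x₀ x₁ L) (hL' : IsContLog (F τ') x₀ x₁ L') : L x₁ - L x₀ = L' x₁ - L' x₀ := by
  have hτ₀ : τ₀ ≤ τ₁ := hτ.1.trans hτ.2
  have hK : IsCompact (Icc τ₀ τ₁ ×ˢ Icc x₀ x₁) := isCompact_Icc.prod isCompact_Icc
  have hslice : ∀ σ ∈ Icc τ₀ τ₁, ContinuousOn (F σ) (Icc x₀ x₁) := fun σ hσ =>
    hF.comp (Continuous.prodMk_right σ).continuousOn fun x hx => ⟨hσ, hx⟩
  obtain ⟨m, hm, hmF⟩ := exists_pos_le_norm_of_isCompact hK ⟨(τ₀, x₀), ⟨le_rfl, hτ₀⟩, ⟨le_rfl, hx⟩⟩ hF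
    fun p hp => hne p.1 hp.1 p.2 hp.2
  obtain ⟨δ, hδ, hδF⟩ := Metric.uniformContinuousOn_iff.1 (hK.uniformContinuousOn_of_continuous hF) m hm
  -- the increment at `τ₀`
  obtain ⟨L₀, hL₀⟩ := exists_isContLog (hslice τ₀ ⟨le_rfl, hτ₀⟩) (hne τ₀ ⟨le_rfl, hτ₀⟩)
  set c : ℂ := L₀ x₁ - L₀ x₀ with hc
  have key : ∀ σ ∈ Icc τ₀ τ₁, ∀ Λ, IsContLog (F σ) x₀ x₁ Λ → Λ x₁ - Λ x₀ = c := by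
    refine chain_Icc (Q := fun σ => ∀ Λ, IsContLog (F σ) x₀ x₁ Λ → Λ x₁ - Λ x₀ = c) (half_pos hδ)
      (fun Λ hΛ => hΛ.incr_eq hL₀ hx) ?_
    intro σ hσ σ' hσ' hQ hσσ' Λ' hΛ'
    obtain ⟨Λ, hΛ⟩ := exists_isContLog (hslice σ hσ) (hne σ hσ)
    have hnear : ∀ x ∈ Icc x₀ x₁, ‖F σ' x - F σ x‖ < ‖F σ x‖ := by
      intro x hxx
      have hd : dist (σ', x) (σ, x) < δ := by
        rw [Prod.dist_eq, dist_self, Real.dist_eq]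
        exact max_lt (lt_of_le_of_lt hσσ' (half_lt_self hδ)) hδ
      have := hδF (σ', x) ⟨hσ', hxx⟩ (σ, x) ⟨hσ, hxx⟩ hd
      rw [dist_eq_norm] at this
      exact lt_of_lt_of_le this (hmF (σ, x) ⟨hσ, hxx⟩)
    have hends' : F σ' x₁ / F σ x₁ = F σ' x₀ / F σ x₀ := by rw [hends σ hσ, hends σ' hσ']
    rw [hΛ.incr_eq_of_near (hslice σ' hσ') hnear hΛ' hx hends']
    exact hQ Λ hΛ
  rw [key τ hτ L hL, key τ' hτ' L' hL']

/-- LOCAL STEP ON A VERTICAL EDGE: if along `[y₀, y₁]` the edge function stays closer to its value at `y` than `‖h (x + iy)‖`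
whenever `|u − y| ≤ |y' − y|`, then `Λ y' − Λ y = log (h (x + iy') / h (x + iy))` for every continuous logarithm `Λ`. [folklore] -/
theorem vEdge_incr_eq_log {h : ℂ → ℂ} {x y₀ y₁ y y' : ℝ} {Λ : ℝ → ℂ} (hΛ : IsContLog (vEdge h x) y₀ y₁ Λ)
    (hy : y ∈ Icc y₀ y₁) (hy' : y' ∈ Icc y₀ y₁)
    (hnear : ∀ u ∈ Icc y₀ y₁, |u - y| ≤ |y' - y| → ‖vEdge h x u - vEdge h x y‖ < ‖vEdge h x y‖) :
    Λ y' - Λ y = log (vEdge h x y' / vEdge h x y) := by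
  rcases le_total y y' with hle | hle
  · refine (hΛ.mono hy.1 hy'.2).sub_eq_log_div ⟨le_rfl, hle⟩ (fun u hu => hnear u ⟨hy.1.trans hu.1, hu.2.trans hy'.2⟩ ?_)
      y' ⟨hle, le_rfl⟩
    rw [abs_of_nonneg (sub_nonneg.mpr hu.1), abs_of_nonneg (sub_nonneg.mpr hle)]; linarith [hu.2]
  · refine (hΛ.mono hy'.1 hy.2).sub_eq_log_div ⟨hle, le_rfl⟩ (fun u hu => hnear u ⟨hy'.1.trans hu.1, hu.2.trans hy.2⟩ ?_)
      y' ⟨le_rfl, hle⟩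
    rw [abs_of_nonpos (sub_nonpos.mpr hu.2), abs_of_nonpos (sub_nonpos.mpr hle)]; linarith [hu.1]

/-- **(L1) A ZERO-FREE CONTINUOUS FUNCTION ON THE FILLED RECTANGLE HAS LOOP INCREMENT `0`** (sweep: the loop sum of the
sub-rectangle `[x₀, x₁] × [y₀, y]` vanishes at `y = y₀` and is locally constant in `y` by the ratio lemma on the moving top edge
and the local step on the two vertical edges; ε-chain up to `y = y₁`). [folklore] -/
theorem hasLoopIncr_zero_of_ne_zero {h : ℂ → ℂ} {x₀ x₁ y₀ y₁ : ℝ} (hx : x₀ ≤ x₁) (hy : y₀ ≤ y₁)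
    (hK : ContinuousOn h (Icc x₀ x₁ ×ℂ Icc y₀ y₁)) (hz : ∀ z ∈ Icc x₀ x₁ ×ℂ Icc y₀ y₁, h z ≠ 0) :
    HasLoopIncr h x₀ x₁ y₀ y₁ 0 := by
  have hKc : IsCompact (Icc x₀ x₁ ×ℂ Icc y₀ y₁) := isCompact_Icc.reProdIm isCompact_Icc
  obtain ⟨m, hm, hmh⟩ := exists_pos_le_norm_of_isCompact hKc
    ⟨(x₀ : ℂ) + y₀ * I, (mem_reProdIm_iff x₀ y₀ _ _).mpr ⟨⟨le_rfl, hx⟩, ⟨le_rfl, hy⟩⟩⟩ hK hz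
  obtain ⟨δ, hδ, hδh⟩ := Metric.uniformContinuousOn_iff.1 (hKc.uniformContinuousOn_of_continuous hK) m hm
  have hzE : ∀ x ∈ Icc x₀ x₁, ∀ y ∈ Icc y₀ y₁, h ((x : ℂ) + y * I) ≠ 0 := fun x hx' y hy' =>
    hz _ ((mem_reProdIm_iff x y _ _).mpr ⟨hx', hy'⟩)
  -- fixed logarithms on the bottom, left and right edges
  obtain ⟨Lb, hLb⟩ := exists_isContLog (continuousOn_hEdge hK ⟨le_rfl, hy⟩) fun x hx' => hzE x hx' y₀ ⟨le_rfl, hy⟩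
  obtain ⟨Ll, hLl⟩ := exists_isContLog (continuousOn_vEdge hK ⟨le_rfl, hx⟩) fun y hy' => hzE x₀ ⟨le_rfl, hx⟩ y hy'
  obtain ⟨Lr, hLr⟩ := exists_isContLog (continuousOn_vEdge hK ⟨hx, le_rfl⟩) fun y hy' => hzE x₁ ⟨hx, le_rfl⟩ y hy'
  -- the sweep
  have key : ∀ y ∈ Icc y₀ y₁, ∀ T, IsContLog (hEdge h y) x₀ x₁ T →
      (Lb x₁ - Lb x₀) + (Lr y - Lr y₀) - (T x₁ - T x₀) - (Ll y - Ll y₀) = 0 := by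
    refine chain_Icc (Q := fun y => ∀ T, IsContLog (hEdge h y) x₀ x₁ T →
      (Lb x₁ - Lb x₀) + (Lr y - Lr y₀) - (T x₁ - T x₀) - (Ll y - Ll y₀) = 0) (half_pos hδ) ?_ ?_
    · intro T hT; rw [hT.incr_eq hLb hx]; ring
    intro y hy' y' hy'' hQ hyy T' hT'
    obtain ⟨T, hT⟩ := exists_isContLog (continuousOn_hEdge hK hy') fun x hx' => hzE x hx' y hy'
    have hclose : ∀ x ∈ Icc x₀ x₁, ∀ u ∈ Icc y₀ y₁, |u - y| ≤ |y' - y| →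
        ‖h ((x : ℂ) + u * I) - h ((x : ℂ) + y * I)‖ < ‖h ((x : ℂ) + y * I)‖ := by
      intro x hx' u hu huy
      have hd : dist ((x : ℂ) + u * I) ((x : ℂ) + y * I) < δ := by
        rw [dist_eq_norm, show ((x : ℂ) + u * I) - ((x : ℂ) + y * I) = ((u - y : ℝ) : ℂ) * I by push_cast; ring,
          norm_mul, norm_I, mul_one, norm_real, Real.norm_eq_abs]
        exact lt_of_le_of_lt (huy.trans hyy) (half_lt_self hδ)
      have := hδh _ ((mem_reProdIm_iff x u _ _).mpr ⟨hx', hu⟩) _ ((mem_reProdIm_iff x y _ _).mpr ⟨hx', hy'⟩) hd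
      rw [dist_eq_norm] at this
      exact lt_of_lt_of_le this (hmh _ ((mem_reProdIm_iff x y _ _).mpr ⟨hx', hy'⟩))
    have hnear : ∀ x ∈ Icc x₀ x₁, ‖hEdge h y' x - hEdge h y x‖ < ‖hEdge h y x‖ := fun x hx' =>
      hclose x hx' y' hy'' le_rfl
    have eT := hT.incr_eq_of_near' (continuousOn_hEdge hK hy'') hnear hT' hx
    have eR := vEdge_incr_eq_log hLr hy' hy'' fun u hu huy => hclose x₁ ⟨hx, le_rfl⟩ u hu huy
    have eL := vEdge_incr_eq_log hLl hy' hy'' fun u hu huy => hclose x₀ ⟨le_rfl, hx⟩ u hu huy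
    have h0 := hQ T hT
    simp only [hEdge_apply, vEdge_apply] at eT eR eL ⊢
    linear_combination h0 + eR - eL - eT
  obtain ⟨Lt, hLt⟩ := exists_isContLog (continuousOn_hEdge hK ⟨hy, le_rfl⟩) fun x hx' => hzE x hx' y₁ ⟨hy, le_rfl⟩
  refine ⟨Lb, Lt, Ll, Lr, ⟨hLb, hLt, hLl, hLr⟩, ?_⟩
  rw [loopSum, key y₁ ⟨hy, le_rfl⟩ Lt hLt]

end

end Summit.QuantumFields.BalabanUV.Beta.LoopIncrement
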